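import Mathlib

/-!
# Tier4/Common/HaarPiTransport — Haar measure along a continuous isomorphism `G ≃ₜ* ∀ i, H i` onto a FINITE product:
the product of Haar measures is Haar, Haar uniqueness pins the scalar, the integral transports, and a product integrand
integrates to the product of the factor integrals

Blind re-derivation cell `pub-hodge-repro`, Tier 4 (README §9–§10), seat t4-L2-p1 (gen 3; L4 service prover).  Target
tree path `lean/Summits/Ventures/HodgeRepro/Tier4/Common/HaarPiTransport.lean`.  Imports Mathlib only.

WHAT IS TYPED — the finite-product analogue of t4-typer-1's `HaarProductTransport` (p695471, two factors), i.e. the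
GENERIC half (4) of typer-2 g4's C-COMMON-ARCHSPLIT offer (S14892: `T_∞ ≃ₜ* ∏_w T_w`, the archimedean analogue of
`torusSplit`), for ANY continuous group isomorphism `e : G ≃ₜ* ∀ i, H i` of topological groups with Borel σ-algebras,
`ι` finite, the factors locally compact and second countable:
* **`isHaarMeasure_map_symm_pi`**: for Haar measures `ν i` the push-forward `Measure.map e.symm (Measure.pi ν)` is a Haar
  measure on `G` (Mathlib: `Measure.pi.isHaarMeasure`, `ContinuousMulEquiv.isHaarMeasure_map`; σ-finiteness of the
  factors from local compactness + second countability);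
* **`exists_smul_map_symm_pi_eq`**: a Haar measure `μ` on `G` is a POSITIVE scalar multiple of that push-forward
  (`isMulLeftInvariant_eq_smul`, `haarScalarFactor_pos_of_isHaarMeasure`);
* **`integral_eq_smul_integral_pi`**: for `μ = c • Measure.map e.symm (Measure.pi ν)` and ANY `F : G → ℂ`,
  `∫ x, F x ∂μ = (c : ℝ) • ∫ κ, F (e.symm κ) ∂(Measure.pi ν)` (`integral_smul_nnreal_measure`, `integral_map_equiv`
  along the measurable equivalence; no integrability and no hypothesis on `c` — the push-forward along a measurable
  equivalence transports the Bochner integral unconditionally);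
* **`integral_eq_smul_prod_integral_of_pi`**: if moreover `F (e.symm κ) = ∏ i, f i (κ i)` for all `κ`, then
  `∫ x, F x ∂μ = (c : ℝ) • ∏ i, ∫ y, f i y ∂(ν i)` (Mathlib's `integral_fintype_prod_eq_prod`, unconditional on σ-finite
  factors).
At `e := torusInfSplit` (typer-2's (3)) with `e.symm = assemble` these are S14892 (4) verbatim; the adelic objects are NOT
mentioned here — this file knows nothing of the cell's tori.

Nothing here says anything about the status of the Hodge conjecture for CM abelian varieties, which is NOT proved
(HC_CM is NOT proved by anyone in this repository).
-/

set_option autoImplicit false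

noncomputable section

open MeasureTheory Measure Filter Topology
open scoped NNReal ENNReal

namespace Summit.Ventures.HodgeRepro.Tier4.Common

section HaarPiTransport

variable {ι : Type*} [Fintype ι] {G : Type*} {H : ι → Type*}
  [Group G] [TopologicalSpace G] [IsTopologicalGroup G] [MeasurableSpace G] [BorelSpace G]
  [∀ i, Group (H i)] [∀ i, TopologicalSpace (H i)] [∀ i, IsTopologicalGroup (H i)]
  [∀ i, MeasurableSpace (H i)] [∀ i, BorelSpace (H i)]

/-- **The push-forward of a finite product of Haar measures along the inverse of a continuous isomorphism
`G ≃ₜ* ∀ i, H i` is a Haar measure on `G`.**  The factors are locally compact and second countable (so that the Haar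
measures are σ-finite and the product carries the Borel σ-algebra); `e.symm` is measurable because it is continuous. -/
theorem isHaarMeasure_map_symm_pi
    [∀ i, LocallyCompactSpace (H i)] [∀ i, SecondCountableTopology (H i)]
    (e : G ≃ₜ* ∀ i, H i) (ν : ∀ i, Measure (H i)) [∀ i, (ν i).IsHaarMeasure] :
    (Measure.map e.symm (Measure.pi ν)).IsHaarMeasure := by
  haveI : ∀ i, IsLocallyFiniteMeasure (ν i) := fun i => isLocallyFiniteMeasure_of_isFiniteMeasureOnCompacts
  haveI : ∀ i, SigmaFinite (ν i) := fun i => sigmaFinite_of_locallyFinite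
  haveI : BorelSpace (∀ i, H i) := Pi.borelSpace
  exact ContinuousMulEquiv.isHaarMeasure_map (Measure.pi ν) e.symm

/-- **Haar uniqueness along `G ≃ₜ* ∀ i, H i`**: a Haar measure `μ` on `G` is a POSITIVE scalar multiple of the
push-forward of `Measure.pi ν` (`G` locally compact and second countable). -/
theorem exists_smul_map_symm_pi_eq
    [LocallyCompactSpace G] [SecondCountableTopology G]
    [∀ i, LocallyCompactSpace (H i)] [∀ i, SecondCountableTopology (H i)]
    (e : G ≃ₜ* ∀ i, H i) (μ : Measure G) [μ.IsHaarMeasure]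
    (ν : ∀ i, Measure (H i)) [∀ i, (ν i).IsHaarMeasure] :
    ∃ c : ℝ≥0, 0 < c ∧ μ = c • Measure.map e.symm (Measure.pi ν) := by
  haveI := isHaarMeasure_map_symm_pi e ν
  exact ⟨haarScalarFactor μ (Measure.map e.symm (Measure.pi ν)), haarScalarFactor_pos_of_isHaarMeasure _ _,
    isMulLeftInvariant_eq_smul _ _⟩

omit [IsTopologicalGroup G] [∀ i, IsTopologicalGroup (H i)] in
/-- **The integral against `μ = c • (e.symm)_*(Measure.pi ν)` is `c` times the integral over the product.**  No
integrability and no hypothesis on `c` (`integral_map_equiv` is unconditional). -/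
theorem integral_eq_smul_integral_pi
    [∀ i, LocallyCompactSpace (H i)] [∀ i, SecondCountableTopology (H i)]
    (e : G ≃ₜ* ∀ i, H i) (μ : Measure G)
    (ν : ∀ i, Measure (H i)) [∀ i, (ν i).IsHaarMeasure]
    (c : ℝ≥0) (hc : μ = c • Measure.map e.symm (Measure.pi ν)) (F : G → ℂ) :
    ∫ x, F x ∂μ = (c : ℝ) • ∫ κ, F (e.symm κ) ∂(Measure.pi ν) := by
  haveI : BorelSpace (∀ i, H i) := Pi.borelSpace
  subst hc
  have hmeq : Measure.map e.symm (Measure.pi ν) =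
      Measure.map (e.symm.toHomeomorph.toMeasurableEquiv) (Measure.pi ν) := rfl
  rw [integral_smul_nnreal_measure, NNReal.smul_def, hmeq, integral_map_equiv]
  rfl

omit [IsTopologicalGroup G] [∀ i, IsTopologicalGroup (H i)] in
/-- **A product integrand integrates to the product of the factor integrals**: for
`μ = c • (e.symm)_*(Measure.pi ν)` and `F (e.symm κ) = ∏ i, f i (κ i)`,
`∫ x, F x ∂μ = c • ∏ i, ∫ y, f i y ∂(ν i)` (Mathlib's `integral_fintype_prod_eq_prod`). -/
theorem integral_eq_smul_prod_integral_of_pi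
    [∀ i, LocallyCompactSpace (H i)] [∀ i, SecondCountableTopology (H i)]
    (e : G ≃ₜ* ∀ i, H i) (μ : Measure G)
    (ν : ∀ i, Measure (H i)) [∀ i, (ν i).IsHaarMeasure]
    (c : ℝ≥0) (hc : μ = c • Measure.map e.symm (Measure.pi ν)) (F : G → ℂ)
    (f : ∀ i, H i → ℂ) (hf : ∀ κ : ∀ i, H i, F (e.symm κ) = ∏ i, f i (κ i)) :
    ∫ x, F x ∂μ = (c : ℝ) • ∏ i, ∫ y, f i y ∂(ν i) := by
  haveI : ∀ i, IsLocallyFiniteMeasure (ν i) := fun i => isLocallyFiniteMeasure_of_isFiniteMeasureOnCompacts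
  haveI : ∀ i, SigmaFinite (ν i) := fun i => sigmaFinite_of_locallyFinite
  rw [integral_eq_smul_integral_pi e μ ν c hc F]
  congr 1
  simp_rw [hf]
  exact integral_fintype_prod_eq_prod f

end HaarPiTransport

end Summit.Ventures.HodgeRepro.Tier4.Common

end
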